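import Literature.NumberTheory.Automorphic.SymplecticSatakeOrbitSumBasis
import Literature.NumberTheory.Automorphic.SymplecticHeckeAlgebraStructure
import Literature.NumberTheory.Automorphic.SplitOrthogonalSatakeOrbitSumBasis
import HarnessLib

/-!
# The mod-`p` Satake isomorphism for `Sp_{2n}` (Herzig Thm. 1.2 / Cor. 1.3, Henniart–Vignéras Thm. 1.5, trivial weight, every rank):
# for every commutative ring `R` with `q = 0` in `R`, `𝒮_1 : ℋ(Sp_{2n}(K), Sp_{2n}(𝒪); R) ⥲ R[Λ⁺]`, `Λ⁺ ⊆ ℤⁿ` the dominant cone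

Topic `NumberTheory/Automorphic`; namespace `Literature.NumberTheory.Automorphic.SymplecticCartan` (lane `lit-hodgefound`,
Track 2 foundations; seat `lit-hodgefound-p11`, generation 50, row g50-#12).  Two DEFINITIONS with bodies (`symplecticDominantCone n`,
the additive submonoid `Λ⁺ = {μ ∈ ℤⁿ : μ₀ ≥ μ₁ ≥ ⋯ ≥ μ_{n-1} ≥ 0}`; `symplecticSatakeModPAlgEquiv`) + theorems; no named fact, no
instance, no notation.  The `Sp_{2n}` analogue of `HyperspecialUnitarySatakeModP` (g49-#7) and `SatakeIsomorphismCharPGL`, on top of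
g50-#8 (`𝒮_1(ℋ_R) = 𝒯_R(q)`) and g50-#11 (the dominant element is the unique `⟨ρ,·⟩`-maximum of its `W(C_n)`-orbit).

## The print

[Herzig2010] Thm. 1.2 (`F/ℚ_p` finite, `G` unramified — e.g. `Sp_{2n}` —, `K` hyperspecial, `V` irreducible over `𝔽̄_p`):
«`𝒮 : ℋ_G(V) → ℋ_T(V^{U(k)})` […] is an injective `k̄`-algebra homomorphism with image `ℋ⁻_T(V^{U(k)})`» (the functions
supported on the antidominant monoid `T⁻`); Cor. 1.3: «`ℋ_G(V)` is commutative and isomorphic to `k̄[X_*(S)_-]`.  In particular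
it is noetherian»; §1.2 («when `V` is trivial […] the image of the Satake transform is `W`-invariant and the modulus character is
a power of `p` which, among the `W`-conjugates of a given coweight, is biggest on the antidominant one»).  [HenniartVigneras2013]
Thm. 1.5 (any local `F`, `C` a field of characteristic `p`, `V = C`): «(i) `S` injective. (ii) Its image is the space of functions
supported on antidominant elements»; §7.15 Thm. and Remark 1 (any commutative `C` with `p · 1_C = 0`: `1_C ⊗ S_λ = 1_C ⊗ e_λ`).

HERE `G = Sp_{2n}(K)` for ANY non-archimedean `K` with compact `𝒪` and ANY commutative `R` with `q = #𝓀 = 0` in `R` (e.g.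
`char R = char 𝓀`), in the tree's DOMINANT convention (`x^μ ↔ x^{-μ}`, `-1 ∈ W(C_n)`; g50-#8): the counting transform
`𝒮_1 = symplecticSatakeTransform hϖ 1` (Herzig's `𝒮'` without `δ^{1/2}`, injective over every `R`,
`symplecticSatakeTransform_injective_of_commRing`) has image EXACTLY the functions supported on the dominant cone `Λ⁺`, and
`Λ⁺` is an additive monoid, so `ℋ_R ≃ₐ[R] R[Λ⁺]`.  PROOF: `𝒮_1(ℋ_R) = 𝒯_R(q)` (g50-#8) is cut out by
`f_{wμ} = q^{⟨ρ,μ⟩-⟨ρ,wμ⟩} f_μ` (`⟨ρ,wμ⟩ ≤ ⟨ρ,μ⟩`); every `μ` has a dominant `W(C_n)`-conjugate `λ` with `⟨ρ,μ⟩ ≤ ⟨ρ,λ⟩`,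
equality iff `μ = λ` (g50-#11); with `q = 0` the relation at `(λ, w)` kills `f_μ` unless `μ = λ`; conversely a function supported
on `Λ⁺` satisfies all relations (both sides vanish unless `wμ = μ`).

## What is formalised

* §1 **`mem_symplecticTwistedTarget_iff_forall_dominant_of_cast_eq_zero`** (`(b : R) = 0 ⇒ (f ∈ 𝒯_R(b) ⟺ supp f ⊆ Λ⁺)`).
* §2 `symplecticDominantCone n` (+ `mem_symplecticDominantCone_iff`), `coneEmbedding` = `R[Λ⁺] →ₐ[R] R[ℤⁿ]` (+ `_injective`,
  `mem_range_coneEmbedding_iff`).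
* §3 **`antitone_nonneg_of_coeff_symplecticSatakeTransform_one_ne_zero`** (THM. 1.2, support half),
  **`mem_range_symplecticSatakeTransform_one_iff_of_cast_eq_zero`** (THM. 1.2 / HV THM. 1.5 (ii): `f ∈ 𝒮_1(ℋ_R) ⟺ supp f ⊆ Λ⁺`),
  `single_mem_range_symplecticSatakeTransform_one` (HV §7.15 Rem. 1), `mem_range_symplecticSatakeTransform_one_iff_of_charP`,
  **`symplecticSatakeModPAlgEquiv hϖ hq : ℋ(Sp_{2n}(K), Sp_{2n}(𝒪); R) ≃ₐ[R] R[Λ⁺]`** (COR. 1.3) + `coneEmbedding_symplecticSatakeModPAlgEquiv`,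
  `isNoetherianRing_heckeAlgebra_symplecticInt` (COR. 1.3 «noetherian», every noetherian `R`, from the tree's `ℋ_R ≅ R[X_1,…,X_n]`).

## References
* [Herzig2010] F. Herzig, *A Satake isomorphism in characteristic p*, Compositio Math. 147 (2011) 263–283, Thm. 1.2, Cor. 1.3, §1.2.
* [HenniartVigneras2013] G. Henniart, M.-F. Vignéras, *A Satake isomorphism for representations modulo p of reductive groups over
  local fields*, J. reine angew. Math. 701 (2015) 33–75, Thm. 1.5, §7.15 Thm. and Remark 1.
* [ZhuIntegralSatake2020] X. Zhu, *A note on integral Satake isomorphisms*, arXiv:2005.13056, §1.4 (relation with [He, HV]).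
-/

noncomputable section

open scoped Valued WithZero MatrixGroups
open Matrix MonoidAlgebra Representation

namespace Literature.NumberTheory.Automorphic.SymplecticCartan

open Literature.NumberTheory.Automorphic Literature.NumberTheory.Automorphic.CartanUnique

variable {R : Type*} [CommRing R] {n : ℕ}

/-! ## §1 The twisted invariants at `b = 0`: functions supported on the dominant cone -/

/-- **`𝒯_R(b) = R[Λ⁺]` when `b = 0` in `R`**: `f ∈ 𝒯_R(b)` iff every exponent of `f` is dominant (antitone and `≥ 0`).
[cite: Herzig2010, Thm. 1.2, §1.2] [cite: HenniartVigneras2013, Thm. 1.5 (ii), §7.15 Remark 1] -/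
theorem mem_symplecticTwistedTarget_iff_forall_dominant_of_cast_eq_zero {b : ℕ} (hb : (b : R) = 0)
    (f : AddMonoidAlgebra R (Fin n → ℤ)) :
    f ∈ symplecticTwistedTarget R n b ↔ ∀ μ : Fin n → ℤ, f.coeff μ ≠ 0 → Antitone μ ∧ ∀ i, 0 ≤ μ i := by
  constructor
  · intro hf μ hμ
    obtain ⟨la, hla, hmem, -⟩ := exists_dominant_coeff_ne_zero_of_mem_twisted hf hμ
    obtain ⟨ε, π, hw⟩ := mem_signedPermOrbit_iff.1 hmem
    -- the relation at `(λ, w)`, `wλ = μ`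
    have hle : symplecticRhoPairing (fun i => (ε i : ℤ) * la (π i)) ≤ symplecticRhoPairing la :=
      symplecticRhoPairing_signedPerm_le hla.1 hla.2 ε π
    have hrel := hf la ε π hle
    by_cases heq : (fun i => (ε i : ℤ) * la (π i)) = la
    · rw [← hw, heq]; exact hla
    · have hlt : symplecticRhoPairing (fun i => (ε i : ℤ) * la (π i)) < symplecticRhoPairing la :=
        lt_of_le_of_ne hle fun h => heq (signedPerm_eq_self_of_le hla.1 hla.2 ε π h.ge)
      rw [hb, zero_pow (by omega), zero_mul, hw] at hrel
      exact absurd hrel hμ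
  · intro h μ ε π hle
    by_cases hμ0 : f.coeff μ = 0
    · rw [hμ0, mul_zero]
      by_contra hne
      -- `wμ` is dominant and `μ` lies in its orbit with `⟨ρ,wμ⟩ ≤ ⟨ρ,μ⟩`: so `μ = wμ`
      have hd := h _ hne
      have hmem : μ ∈ signedPermOrbit (fun i => (ε i : ℤ) * μ (π i)) :=
        mem_signedPermOrbit_comm.1 (mem_signedPermOrbit_iff.2 ⟨ε, π, rfl⟩)
      obtain ⟨ε', π', hw'⟩ := mem_signedPermOrbit_iff.1 hmem
      have heq := signedPerm_eq_self_of_le hd.1 hd.2 ε' π' (by rw [hw']; exact hle)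
      rw [hw'] at heq
      rw [← heq] at hne
      exact hne hμ0
    · have hd := h μ hμ0
      by_cases heq : (fun i => (ε i : ℤ) * μ (π i)) = μ
      · rw [heq, sub_self, Int.toNat_zero, pow_zero, one_mul]
      · have hlt : symplecticRhoPairing (fun i => (ε i : ℤ) * μ (π i)) < symplecticRhoPairing μ :=
          lt_of_le_of_ne hle fun h' => heq (signedPerm_eq_self_of_le hd.1 hd.2 ε π h'.ge)
        rw [hb, zero_pow (by omega), zero_mul]
        by_contra hne
        exact heq (eq_of_dominant_of_mem_signedPermOrbit hd.1 hd.2 (h _ hne).1 (h _ hne).2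
          (mem_signedPermOrbit_iff.2 ⟨ε, π, rfl⟩))

/-! ## §2 The dominant cone `Λ⁺` and `R[Λ⁺] ⊆ R[ℤⁿ]` -/

variable (n) in
/-- **The dominant cone `Λ⁺ = {μ ∈ ℤⁿ : μ₀ ≥ μ₁ ≥ ⋯ ≥ μ_{n-1} ≥ 0}`**, an additive submonoid of `ℤⁿ` (the tree's indexing of the
Cartan representatives `d(a) = diag(ϖ^a; ϖ^{-a})`; Herzig's `X_*(S)_-` up to the sign convention). [cite: Herzig2010, Def. 1.1, Cor. 1.3] -/
def symplecticDominantCone : AddSubmonoid (Fin n → ℤ) where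
  carrier := {μ | Antitone μ ∧ ∀ i, 0 ≤ μ i}
  add_mem' {a b} ha hb := ⟨ha.1.add hb.1, fun i => by rw [Pi.add_apply]; exact add_nonneg (ha.2 i) (hb.2 i)⟩
  zero_mem' := ⟨antitone_const, fun _ => le_rfl⟩

/-- Membership in `Λ⁺`. [cite: Herzig2010, Def. 1.1] -/
theorem mem_symplecticDominantCone_iff (μ : Fin n → ℤ) : μ ∈ symplecticDominantCone n ↔ Antitone μ ∧ ∀ i, 0 ≤ μ i := Iff.rfl

variable (R n) in
/-- **`R[Λ⁺] →ₐ[R] R[ℤⁿ]`**, the inclusion of the monoid algebra of the dominant cone. [cite: Herzig2010, Cor. 1.3] -/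
def coneEmbedding : AddMonoidAlgebra R (symplecticDominantCone n) →ₐ[R] AddMonoidAlgebra R (Fin n → ℤ) :=
  AddMonoidAlgebra.mapDomainAlgHom R R (symplecticDominantCone n).subtype

/-- `coneEmbedding` is `Finsupp.mapDomain` along the inclusion. [cite: Herzig2010, Cor. 1.3] -/
theorem coneEmbedding_apply (g : AddMonoidAlgebra R (symplecticDominantCone n)) :
    coneEmbedding R n g = AddMonoidAlgebra.mapDomain ((↑) : symplecticDominantCone n → (Fin n → ℤ)) g := rfl

/-- `coneEmbedding (x^c) = x^c`. [cite: Herzig2010, Cor. 1.3] -/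
theorem coneEmbedding_single (c : symplecticDominantCone n) (r : R) :
    coneEmbedding R n (AddMonoidAlgebra.single c r) = AddMonoidAlgebra.single (c : Fin n → ℤ) r := by
  rw [coneEmbedding_apply, AddMonoidAlgebra.mapDomain_single]

/-- The inclusion `R[Λ⁺] → R[ℤⁿ]` is injective. [cite: Herzig2010, Cor. 1.3] -/
theorem coneEmbedding_injective : Function.Injective (coneEmbedding R n) := by
  intro g g' h
  rw [coneEmbedding_apply, coneEmbedding_apply] at h
  exact AddMonoidAlgebra.mapDomain_injective Subtype.val_injective h

/-- **`range (R[Λ⁺] → R[ℤⁿ])` = the functions supported on `Λ⁺`.** [cite: Herzig2010, Thm. 1.2] -/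
theorem mem_range_coneEmbedding_iff (f : AddMonoidAlgebra R (Fin n → ℤ)) :
    f ∈ (coneEmbedding R n).range ↔ ∀ μ : Fin n → ℤ, f.coeff μ ≠ 0 → Antitone μ ∧ ∀ i, 0 ≤ μ i := by
  classical
  constructor
  · rintro ⟨g, rfl⟩ μ hμ
    change (AddMonoidAlgebra.mapDomain ((↑) : symplecticDominantCone n → (Fin n → ℤ)) g).coeff μ ≠ 0 at hμ
    rw [AddMonoidAlgebra.coeff_mapDomain] at hμ
    have hs := Finsupp.mapDomain_support (f := ((↑) : symplecticDominantCone n → (Fin n → ℤ))) (s := g.coeff)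
      (Finsupp.mem_support_iff.2 hμ)
    obtain ⟨c, -, rfl⟩ := Finset.mem_image.1 hs
    exact c.2
  · intro h
    have hsupp : ↑f.coeff.support ⊆ Set.range ((↑) : symplecticDominantCone n → (Fin n → ℤ)) := by
      intro μ hμ
      exact ⟨⟨μ, h μ (Finsupp.mem_support_iff.1 hμ)⟩, rfl⟩
    refine ⟨AddMonoidAlgebra.ofCoeff
      (Finsupp.comapDomain ((↑) : symplecticDominantCone n → (Fin n → ℤ)) f.coeff Subtype.val_injective.injOn), ?_⟩
    change AddMonoidAlgebra.mapDomain ((↑) : symplecticDominantCone n → (Fin n → ℤ)) _ = f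
    refine AddMonoidAlgebra.coeff_injective ?_
    rw [AddMonoidAlgebra.coeff_mapDomain, AddMonoidAlgebra.coeff_ofCoeff]
    exact Finsupp.mapDomain_comapDomain _ Subtype.val_injective f.coeff hsupp

/-! ## §3 The mod-`p` Satake isomorphism for `Sp_{2n}` -/

section Hecke

variable {K : Type*} [Field K] [Valued K ℤᵐ⁰] {ϖ : K} [CompactSpace 𝒪[K]] [Finite 𝓀[K]]

/-- **HERZIG'S THEOREM 1.2 FOR `Sp_{2n}`, SUPPORT HALF: when `q = 0` in `R`, every exponent of `𝒮_1(T)` is dominant**, for every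
`T ∈ ℋ(Sp_{2n}(K), Sp_{2n}(𝒪); R)`. [cite: Herzig2010, Thm. 1.2, §1.2] [cite: HenniartVigneras2013, Thm. 1.5 (ii)] -/
theorem antitone_nonneg_of_coeff_symplecticSatakeTransform_one_ne_zero (hϖ : Valued.v ϖ = WithZero.exp (-1 : ℤ))
    (hq : ((Nat.card 𝓀[K] : ℕ) : R) = 0) (T : heckeAlgebra R (symplecticGroup (Fin n) K) (symplecticInt (Fin n) K))
    {μ : Fin n → ℤ} (hμ : (symplecticSatakeTransform hϖ 1 T).coeff μ ≠ 0) : Antitone μ ∧ ∀ i, 0 ≤ μ i :=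
  (mem_symplecticTwistedTarget_iff_forall_dominant_of_cast_eq_zero hq _).1 (symplecticSatakeTransform_one_mem_twisted hϖ T) μ hμ

/-- **HERZIG'S THEOREM 1.2 / HENNIART–VIGNÉRAS' THEOREM 1.5 FOR `Sp_{2n}` (trivial weight), OVER EVERY COMMUTATIVE RING `R` WITH
`q = 0` IN `R`**: `f ∈ R[ℤⁿ]` is the counting transform `𝒮_1(T)` of some `T ∈ ℋ(Sp_{2n}(K), Sp_{2n}(𝒪); R)` iff every exponent of
`f` is dominant — `𝒮_1(ℋ_R) = R[Λ⁺]`. [cite: Herzig2010, Thm. 1.2] [cite: HenniartVigneras2013, Thm. 1.5 (ii), §7.15 Thm. and Remark 1] -/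
theorem mem_range_symplecticSatakeTransform_one_iff_of_cast_eq_zero (hϖ : Valued.v ϖ = WithZero.exp (-1 : ℤ))
    (hq : ((Nat.card 𝓀[K] : ℕ) : R) = 0) (f : AddMonoidAlgebra R (Fin n → ℤ)) :
    f ∈ (symplecticSatakeTransform (n := n) (K := K) hϖ (1 : Rˣ)).range ↔
      ∀ μ : Fin n → ℤ, f.coeff μ ≠ 0 → Antitone μ ∧ ∀ i, 0 ≤ μ i := by
  rw [← mem_symplecticTwistedTarget_iff_forall_dominant_of_cast_eq_zero hq, ← range_symplecticSatakeTransform_one_eq_twisted hϖ,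
    AlgHom.mem_range, LinearMap.mem_range]
  rfl

/-- **Every dominant monomial is a transform when `q = 0` in `R`**: `x^c ∈ 𝒮_1(ℋ_R)` for `c ∈ Λ⁺`.
[cite: HenniartVigneras2013, §7.15 Remark 1] [cite: Herzig2010, Thm. 1.2] -/
theorem single_mem_range_symplecticSatakeTransform_one (hϖ : Valued.v ϖ = WithZero.exp (-1 : ℤ))
    (hq : ((Nat.card 𝓀[K] : ℕ) : R) = 0) {c : Fin n → ℤ} (hc : Antitone c ∧ ∀ i, 0 ≤ c i) :
    AddMonoidAlgebra.single c (1 : R) ∈ (symplecticSatakeTransform (n := n) (K := K) hϖ (1 : Rˣ)).range := by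
  classical
  rw [mem_range_symplecticSatakeTransform_one_iff_of_cast_eq_zero hϖ hq]
  intro μ hμ
  rw [AddMonoidAlgebra.coeff_single, Finsupp.single_apply] at hμ
  by_cases h : c = μ
  · rw [← h]; exact hc
  · exact absurd (if_neg h) hμ

/-- **The mod-`p` Satake image in characteristic `p = char 𝓀`**: for every commutative ring `R` of characteristic `p`,
`f ∈ 𝒮_1(ℋ(Sp_{2n}(K), Sp_{2n}(𝒪); R))` iff every exponent of `f` is dominant. [cite: Herzig2010, Thm. 1.2]
[cite: HenniartVigneras2013, Thm. 1.5 (ii)] -/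
theorem mem_range_symplecticSatakeTransform_one_iff_of_charP (hϖ : Valued.v ϖ = WithZero.exp (-1 : ℤ)) (p : ℕ) [CharP 𝓀[K] p]
    [CharP R p] (f : AddMonoidAlgebra R (Fin n → ℤ)) :
    f ∈ (symplecticSatakeTransform (n := n) (K := K) hϖ (1 : Rˣ)).range ↔
      ∀ μ : Fin n → ℤ, f.coeff μ ≠ 0 → Antitone μ ∧ ∀ i, 0 ≤ μ i :=
  mem_range_symplecticSatakeTransform_one_iff_of_cast_eq_zero hϖ
    (HermitianLattice.UnramifiedLocalConjDatum.natCast_card_residueField_eq_zero_of_charP (K := K) (R := R) p) f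

/-- `range 𝒮_1 = range (R[Λ⁺] → R[ℤⁿ])` when `q = 0` in `R`. [cite: Herzig2010, Thm. 1.2] -/
theorem range_symplecticSatakeTransform_one_eq_range_coneEmbedding (hϖ : Valued.v ϖ = WithZero.exp (-1 : ℤ))
    (hq : ((Nat.card 𝓀[K] : ℕ) : R) = 0) :
    (symplecticSatakeTransform (n := n) (K := K) hϖ (1 : Rˣ)).range = (coneEmbedding R n).range :=
  Subalgebra.ext fun f => by
    rw [mem_range_symplecticSatakeTransform_one_iff_of_cast_eq_zero hϖ hq, mem_range_coneEmbedding_iff]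

/-- **HERZIG'S COROLLARY 1.3 FOR `Sp_{2n}`: `ℋ(Sp_{2n}(K), Sp_{2n}(𝒪); R) ≃ₐ[R] R[Λ⁺]` when `q = 0` in `R`** — the counting
transform followed by the identification of its image with the monoid algebra of the dominant cone. [cite: Herzig2010, Cor. 1.3]
[cite: HenniartVigneras2013, Thm. 1.5, §7.15] -/
def symplecticSatakeModPAlgEquiv (hϖ : Valued.v ϖ = WithZero.exp (-1 : ℤ)) (hq : ((Nat.card 𝓀[K] : ℕ) : R) = 0) :
    heckeAlgebra R (symplecticGroup (Fin n) K) (symplecticInt (Fin n) K) ≃ₐ[R] AddMonoidAlgebra R (symplecticDominantCone n) :=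
  ((AlgEquiv.ofInjective _ (symplecticSatakeTransform_injective_of_commRing hϖ (1 : Rˣ))).trans
    (Subalgebra.equivOfEq _ _ (range_symplecticSatakeTransform_one_eq_range_coneEmbedding hϖ hq))).trans
    (AlgEquiv.ofInjective _ (coneEmbedding_injective (R := R) (n := n))).symm

/-- The mod-`p` isomorphism IS the counting transform: `coneEmbedding (e T) = 𝒮_1(T)`. [cite: Herzig2010, Cor. 1.3] -/
theorem coneEmbedding_symplecticSatakeModPAlgEquiv (hϖ : Valued.v ϖ = WithZero.exp (-1 : ℤ)) (hq : ((Nat.card 𝓀[K] : ℕ) : R) = 0)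
    (T : heckeAlgebra R (symplecticGroup (Fin n) K) (symplecticInt (Fin n) K)) :
    coneEmbedding R n (symplecticSatakeModPAlgEquiv hϖ hq T) = symplecticSatakeTransform hϖ 1 T := by
  rw [symplecticSatakeModPAlgEquiv, AlgEquiv.trans_apply, AlgEquiv.trans_apply]
  set y := Subalgebra.equivOfEq _ _ (range_symplecticSatakeTransform_one_eq_range_coneEmbedding hϖ hq)
    (AlgEquiv.ofInjective _ (symplecticSatakeTransform_injective_of_commRing hϖ (1 : Rˣ)) T) with hy
  have h1 : (y : AddMonoidAlgebra R (Fin n → ℤ)) = symplecticSatakeTransform hϖ 1 T := rfl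
  rw [← h1]
  exact congrArg Subtype.val ((AlgEquiv.ofInjective _ (coneEmbedding_injective (R := R) (n := n))).apply_symm_apply y)

omit [CompactSpace 𝒪[K]] [Finite 𝓀[K]] in
/-- **HERZIG'S COROLLARY 1.3 «In particular it is noetherian» FOR `Sp_{2n}`, over every noetherian commutative ring `R`**
(from `ℋ(Sp_{2n}(K), Sp_{2n}(𝒪); R) ≅ R[X_1, …, X_n]`, `SymplecticHeckeAlgebraStructure`). [cite: Herzig2010, Cor. 1.3]
[cite: HenniartVigneras2013, §7.16] -/
theorem isNoetherianRing_heckeAlgebra_symplecticInt [IsNoetherianRing R] (hϖ : Valued.v ϖ = WithZero.exp (-1 : ℤ))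
    [IsHeckeTriple (⊤ : Submonoid (symplecticGroup (Fin n) K)) (symplecticInt (Fin n) K) (symplecticInt (Fin n) K)] :
    IsNoetherianRing (heckeAlgebra R (symplecticGroup (Fin n) K) (symplecticInt (Fin n) K)) := by
  obtain ⟨e, -⟩ := exists_algEquiv_mvPolynomial_heckeAlgebra_symplecticInt (n := n) (R := R) hϖ
  exact isNoetherianRing_of_ringEquiv _ e.toRingEquiv

end Hecke

end Literature.NumberTheory.Automorphic.SymplecticCartan

end
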